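import Literature.Analysis.FunctionSpaces.PolchinskiSemigroup
import Mathlib.Analysis.InnerProductSpace.Adjoint
import Mathlib.Analysis.Calculus.ContDiff.Basic
import HarnessLib

/-!
# Reduction of a (possibly degenerate) covariance decomposition to a subspace carrying `im C_∞`
# (Bauerschmidt–Bodineau–Dagallier, Theorem 3: the support `X = im C_∞`)

Topic `Literature/Analysis/FunctionSpaces`; companion ("proof architecture") file of
`MultiscaleBakryEmery.lean` (the named fact `Polchinski.BauerschmidtBodineau_multiscaleBakryEmery`,
[BBD] Theorem 3) and of `PolchinskiKernelRigidity.lean`.  [BBD] §3.1 (p0012 L11–13, L56–61) set the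
criterion up for positive SEMIdefinite `C_t` and work on `X = im C_∞ ⊂ ℝ^N` («the measure `P_C` is
supported on the image of `C`»); the tree's proof of Theorem 3
(`Polchinski.logSobolev_of_multiscaleBakryEmery_of_bounded_below`, `PolchinskiLogSobolevBoundedBelow.lean`)
is for NONDEGENERATE decompositions of `ℝ^N`.  This file supplies the TRANSPORT between the two: along a
continuous linear map `L : ℝ^{N'} → ℝ^N` with matrix `B` (`L x = B x`) such that every covariance of the
decomposition is blind to the complement of the range, `S · (B Bᵀ) = S` for `S ∈ {C_t, Ċ_t, C_∞}` (in the
application `L` is an orthonormal frame of `X = (ker C_∞)ᗮ`, so `B Bᵀ` is the orthogonal projection onto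
`X`), the reduced data `C'_t = Bᵀ C_t B` again form a covariance decomposition (`exists_reduced`) and

* the Gaussian measures push forward, `L_* P_{Bᵀ S B} = P_S` (`map_multivariateGaussian_reduce`; Mathlib's
  `IsGaussian.ext` on mean and covariance form) — [BBD] §3.1 «`P_C` is supported on the image of `C`»;
* the renormalised potentials of `V₀' = V₀ ∘ L` are `V'_t = V_t ∘ L` (`renormPotential_reduce`, Def 2);
* the multiscale condition (e:assCt-mon) descends to the reduced data with the same rates
  (`multiscaleCondition_reduce`; chain rule for the second Fréchet derivative along `L`, which needs
  `V_t ∈ C²` — a hypothesis of the named fact);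
* the starting measures correspond, `E_{ν₀}[h] = E_{ν₀'}[h ∘ L]` (`integral_nu0_reduce`, (e:nu0-Cinfty)),
  and so do the Dirichlet forms, `(∇(f∘L), Ċ'_0 ∇(f∘L)) = ((∇f, Ċ₀ ∇f)) ∘ L` (`inner_gradient_reduce`);
* `Bᵀ S B ≻ 0` as soon as `S B` is injective (`posDef_reduce`) — with `PolchinskiKernelRigidity` this makes
  the reduced decomposition nondegenerate.

Also proved here: `ker C_∞ ⊆ ker C_t` and `ker C_∞ ⊆ ker Ċ_t` for all `t ≥ 0`
(`mulVec_C_eq_zero_of_mulVec_Cinf_eq_zero`, `mulVec_Cdot_eq_zero_of_mulVec_Cinf_eq_zero`; monotonicity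
`0 ≤ C_t ≤ C_∞` and the derivative of the vanishing quadratic form).  Everything is stated with explicit
hypotheses on `L`, `B` and a second decomposition `D'` (no new definition, no new named fact); the sibling
`MultiscaleBakryEmeryHolds.lean` instantiates them.  Nothing here is a statement about Yang–Mills.

## References

* [BauerschmidtBodineauDagallier2023] R. Bauerschmidt, T. Bodineau, B. Dagallier, *Stochastic dynamics
  and the Polchinski equation: an introduction*, Probab. Surveys 21 (2024) 200–290, arXiv:2307.07619 —
  §3.1 p0012 L11–13 («`P_C` is supported on the image of `C`»), L56–61 (`X = im C_∞`), Def 2 p0013,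
  (e:nu0-Cinfty) p0013 L22–27, Theorem 3 p0015 L62–90. READ (held text `paper:arxiv-2307.07619`).
-/

noncomputable section

open MeasureTheory ProbabilityTheory Filter Topology Set
open scoped RealInnerProductSpace Matrix MatrixOrder InnerProductSpace

namespace Literature.Analysis.FunctionSpaces

namespace Polchinski

variable {N N' : ℕ}

/-! ### `ker C_∞ ⊆ ker C_t`, `ker C_∞ ⊆ ker Ċ_t` -/

section Kernel

variable (D : CovDecomposition N)

/-- The quadratic form of `C_t` vanishes wherever that of `C_∞` does (`0 ≤ C_t ≤ C_∞`).
[cite: BauerschmidtBodineauDagallier2023, §3.1] -/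
theorem quadForm_C_eq_zero_of_quadForm_Cinf_eq_zero (x : Fin N → ℝ) (hx : x ⬝ᵥ (D.Cinf *ᵥ x) = 0)
    {t : ℝ} (ht : 0 ≤ t) : x ⬝ᵥ (D.C t *ᵥ x) = 0 := by
  have hle : x ⬝ᵥ (D.C t *ᵥ x) ≤ x ⬝ᵥ (D.Cinf *ᵥ x) := by
    have h' := (D.posSemidef_Cinf_sub ht).dotProduct_mulVec_nonneg x
    rw [star_trivial, Matrix.sub_mulVec, dotProduct_sub] at h'
    linarith
  have hge : 0 ≤ x ⬝ᵥ (D.C t *ᵥ x) := by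
    simpa using (D.posSemidef_C ht).dotProduct_mulVec_nonneg x
  rw [hx] at hle
  exact le_antisymm hle hge

/-- **`ker C_∞ ⊆ ker C_t`** for `t ≥ 0`. [cite: BauerschmidtBodineauDagallier2023, §3.1] -/
theorem mulVec_C_eq_zero_of_mulVec_Cinf_eq_zero (x : Fin N → ℝ) (hx : D.Cinf *ᵥ x = 0)
    {t : ℝ} (ht : 0 ≤ t) : D.C t *ᵥ x = 0 := by
  have hq : x ⬝ᵥ (D.Cinf *ᵥ x) = 0 := by rw [hx, dotProduct_zero]
  have hz := quadForm_C_eq_zero_of_quadForm_Cinf_eq_zero D x hq ht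
  exact ((D.posSemidef_C ht).dotProduct_mulVec_zero_iff x).1 (by simpa using hz)

/-- The quadratic form of `Ċ_t` vanishes wherever that of `C_∞` does (`(x, C_s x) ≡ 0` on `[t, ∞)` has
right derivative `(x, Ċ_t x)`). [cite: BauerschmidtBodineauDagallier2023, §3.1] -/
theorem quadForm_Cdot_eq_zero_of_quadForm_Cinf_eq_zero (x : Fin N → ℝ) (hx : x ⬝ᵥ (D.Cinf *ᵥ x) = 0)
    {t : ℝ} (ht : 0 ≤ t) : x ⬝ᵥ (D.Cdot t *ᵥ x) = 0 := by
  have h1 : HasDerivWithinAt (fun s => x ⬝ᵥ (D.C s *ᵥ x)) (x ⬝ᵥ (D.Cdot t *ᵥ x)) (Ici t) t :=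
    (D.hasDerivAt_quadForm_C x ht).hasDerivWithinAt
  have h2 : HasDerivWithinAt (fun s => x ⬝ᵥ (D.C s *ᵥ x)) 0 (Ici t) t := by
    refine (hasDerivWithinAt_const t (Ici t) (0 : ℝ)).congr_of_mem (fun s hs => ?_) (mem_Ici.2 le_rfl)
    exact quadForm_C_eq_zero_of_quadForm_Cinf_eq_zero D x hx (ht.trans hs)
  exact (uniqueDiffOn_Ici t t (mem_Ici.2 le_rfl)).eq_deriv _ h1 h2

/-- **`ker C_∞ ⊆ ker Ċ_t`** for `t ≥ 0`. [cite: BauerschmidtBodineauDagallier2023, §3.1] -/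
theorem mulVec_Cdot_eq_zero_of_mulVec_Cinf_eq_zero (x : Fin N → ℝ) (hx : D.Cinf *ᵥ x = 0)
    {t : ℝ} (ht : 0 ≤ t) : D.Cdot t *ᵥ x = 0 := by
  have hq : x ⬝ᵥ (D.Cinf *ᵥ x) = 0 := by rw [hx, dotProduct_zero]
  have hz := quadForm_Cdot_eq_zero_of_quadForm_Cinf_eq_zero D x hq ht
  exact ((D.posSemidef_Cdot t ht).dotProduct_mulVec_zero_iff x).1 (by simpa using hz)

end Kernel

/-! ### Matrix algebra of the frame `B` -/

section Frame

variable (B : Matrix (Fin N) (Fin N') ℝ)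

/-- `(Bu, y) = (u, Bᵀ y)`. [folklore] -/
private theorem mulVec_dotProduct_eq (u : Fin N' → ℝ) (y : Fin N → ℝ) :
    (B *ᵥ u) ⬝ᵥ y = u ⬝ᵥ (Bᵀ *ᵥ y) := by
  rw [Matrix.dotProduct_mulVec, Matrix.vecMul_transpose]

/-- `(Bᵀ y, u) = (y, B u)`. [folklore] -/
private theorem transpose_mulVec_dotProduct_eq (y : Fin N → ℝ) (u : Fin N' → ℝ) :
    (Bᵀ *ᵥ y) ⬝ᵥ u = y ⬝ᵥ (B *ᵥ u) := by
  rw [Matrix.dotProduct_mulVec, Matrix.mulVec_transpose]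

/-- A symmetric matrix blind to the complement of the frame on the right is blind on the left too:
`S (B Bᵀ) = S`, `Sᵀ = S` give `(B Bᵀ) S = S`, i.e. `B (Bᵀ (S z)) = S z`. [folklore] -/
private theorem proj_mulVec_eq {S : Matrix (Fin N) (Fin N) ℝ} (hS : Sᵀ = S) (hSP : S * (B * Bᵀ) = S)
    (z : Fin N → ℝ) : B *ᵥ (Bᵀ *ᵥ (S *ᵥ z)) = S *ᵥ z := by
  have hPS : B * Bᵀ * S = S := by
    have h := congrArg Matrix.transpose hSP
    rw [Matrix.transpose_mul, Matrix.transpose_mul, Matrix.transpose_transpose, hS] at h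
    exact h
  rw [Matrix.mulVec_mulVec, Matrix.mulVec_mulVec, hPS]

/-- `S (B (Bᵀ y)) = S y` from `S (B Bᵀ) = S`. [folklore] -/
private theorem mulVec_proj_eq {S : Matrix (Fin N) (Fin N) ℝ} (hSP : S * (B * Bᵀ) = S)
    (y : Fin N → ℝ) : S *ᵥ (B *ᵥ (Bᵀ *ᵥ y)) = S *ᵥ y := by
  rw [Matrix.mulVec_mulVec, Matrix.mulVec_mulVec, Matrix.mul_assoc, hSP]

/-- The reduced quadratic form: `(Bu, S Bu') = (u, (Bᵀ S B) u')`. [folklore] -/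
private theorem dotProduct_reduce (S : Matrix (Fin N) (Fin N) ℝ) (u u' : Fin N' → ℝ) :
    (B *ᵥ u) ⬝ᵥ (S *ᵥ (B *ᵥ u')) = u ⬝ᵥ ((Bᵀ * S * B) *ᵥ u') := by
  rw [mulVec_dotProduct_eq, ← Matrix.mulVec_mulVec, ← Matrix.mulVec_mulVec]

/-- The reduced quadratic form at projected vectors: `(Bᵀ y, (Bᵀ S B) Bᵀ y') = (y, S y')` when `S (B Bᵀ) = S`
and `Sᵀ = S`. [folklore] -/
private theorem dotProduct_reduce_proj {S : Matrix (Fin N) (Fin N) ℝ} (hS : Sᵀ = S)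
    (hSP : S * (B * Bᵀ) = S) (y y' : Fin N → ℝ) :
    (Bᵀ *ᵥ y) ⬝ᵥ ((Bᵀ * S * B) *ᵥ (Bᵀ *ᵥ y')) = y ⬝ᵥ (S *ᵥ y') := by
  rw [← dotProduct_reduce, mulVec_proj_eq B hSP, mulVec_dotProduct_eq, transpose_mulVec_dotProduct_eq,
    proj_mulVec_eq B hS hSP]

/-- A positive semidefinite real matrix is symmetric. [folklore] -/
private theorem transpose_eq_of_posSemidef {S : Matrix (Fin N) (Fin N) ℝ} (hS : S.PosSemidef) : Sᵀ = S := by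
  have h := hS.1
  rw [Matrix.IsHermitian, Matrix.conjTranspose_eq_transpose_of_trivial] at h
  exact h

/-- `Bᵀ S B` is positive semidefinite with `S`. [folklore] -/
private theorem posSemidef_reduce {S : Matrix (Fin N) (Fin N) ℝ} (hS : S.PosSemidef) :
    (Bᵀ * S * B).PosSemidef := by
  simpa using hS.conjTranspose_mul_mul_same B

/-- **`Bᵀ S B ≻ 0` when `S B` is injective** (`S` positive semidefinite: `(Bx, S Bx) = 0 ⟹ S B x = 0`).
[cite: BauerschmidtBodineauDagallier2023, §3.1 («if `C` is strictly positive definite …» p0012 L14–17)] -/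
theorem posDef_reduce {S : Matrix (Fin N) (Fin N) ℝ} (hS : S.PosSemidef)
    (hinj : ∀ x : Fin N' → ℝ, S *ᵥ (B *ᵥ x) = 0 → x = 0) : (Bᵀ * S * B).PosDef := by
  refine Matrix.PosDef.of_dotProduct_mulVec_pos (posSemidef_reduce B hS).1 fun x hx => ?_
  rw [star_trivial]
  have h0 : 0 ≤ x ⬝ᵥ ((Bᵀ * S * B) *ᵥ x) := by
    simpa using (posSemidef_reduce B hS).dotProduct_mulVec_nonneg x
  rcases eq_or_lt_of_le h0 with h | h
  · exfalso
    rw [← dotProduct_reduce] at h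
    have hz : S *ᵥ (B *ᵥ x) = 0 := (hS.dotProduct_mulVec_zero_iff (B *ᵥ x)).1 (by simpa using h.symm)
    exact hx (hinj x hz)
  · exact h

end Frame

/-! ### The reduced covariance decomposition `C'_t = Bᵀ C_t B` -/

section Reduced

variable (D : CovDecomposition N) (B : Matrix (Fin N) (Fin N') ℝ)

/-- Entries of `Bᵀ S B` as double sums. [folklore] -/
private theorem reduce_apply (S : Matrix (Fin N) (Fin N) ℝ) (i j : Fin N') :
    (Bᵀ * S * B) i j = ∑ l, ∑ k, B k i * S k l * B l j := by
  simp only [Matrix.mul_apply, Matrix.transpose_apply, Finset.sum_mul]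

/-- **The reduced data `(Bᵀ C_t B, Bᵀ Ċ_t B, Bᵀ C̈_t B, Bᵀ C_∞ B)` form a covariance decomposition of
`ℝ^{N'}`** (entrywise derivatives and limits of finite sums; `Bᵀ Ċ_t B ⪰ 0`; bounded entries).
[cite: BauerschmidtBodineauDagallier2023, §3.1 (covariance decompositions, `X = im C_∞`)] -/
theorem exists_reduced :
    ∃ D' : CovDecomposition N', (∀ t, D'.C t = Bᵀ * D.C t * B) ∧ (∀ t, D'.Cdot t = Bᵀ * D.Cdot t * B) ∧
      (∀ t, D'.Cddot t = Bᵀ * D.Cddot t * B) ∧ D'.Cinf = Bᵀ * D.Cinf * B := by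
  obtain ⟨M, hM⟩ := D.bounded_Cdot
  refine ⟨{ C := fun t => Bᵀ * D.C t * B
            Cdot := fun t => Bᵀ * D.Cdot t * B
            Cddot := fun t => Bᵀ * D.Cddot t * B
            Cinf := Bᵀ * D.Cinf * B
            C_zero := by simp [D.C_zero]
            hasDerivAt_C := ?_
            hasDerivAt_Cdot := ?_
            posSemidef_Cdot := fun t ht => by simpa using (D.posSemidef_Cdot t ht).conjTranspose_mul_mul_same B
            bounded_Cdot := ?_
            tendsto_C := ?_ }, fun t => rfl, fun t => rfl, fun t => rfl, rfl⟩
  · intro t ht i j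
    simp only [reduce_apply]
    refine HasDerivAt.fun_sum fun l _ => HasDerivAt.fun_sum fun k _ => ?_
    exact ((D.hasDerivAt_C t ht k l).const_mul (B k i)).mul_const (B l j)
  · intro t ht i j
    simp only [reduce_apply]
    refine HasDerivAt.fun_sum fun l _ => HasDerivAt.fun_sum fun k _ => ?_
    exact ((D.hasDerivAt_Cdot t ht k l).const_mul (B k i)).mul_const (B l j)
  · set β : ℝ := ∑ i : Fin N', ∑ k : Fin N, |B k i| with hβ
    refine ⟨|M| * β * β, fun t ht i j => ?_⟩
    rw [reduce_apply]
    have hcol : ∀ i : Fin N', ∑ k, |B k i| ≤ β := fun i =>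
      Finset.single_le_sum (f := fun i : Fin N' => ∑ k : Fin N, |B k i|)
        (fun i _ => Finset.sum_nonneg fun k _ => abs_nonneg _) (Finset.mem_univ i)
    have hβ0 : 0 ≤ β := Finset.sum_nonneg fun i _ => Finset.sum_nonneg fun k _ => abs_nonneg _
    calc |∑ l, ∑ k, B k i * D.Cdot t k l * B l j|
        ≤ ∑ l, |∑ k, B k i * D.Cdot t k l * B l j| := Finset.abs_sum_le_sum_abs _ _
      _ ≤ ∑ l, ∑ k, |B k i * D.Cdot t k l * B l j| :=
          Finset.sum_le_sum fun l _ => Finset.abs_sum_le_sum_abs _ _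
      _ ≤ ∑ l, ∑ k, |B k i| * |M| * |B l j| := by
          refine Finset.sum_le_sum fun l _ => Finset.sum_le_sum fun k _ => ?_
          rw [abs_mul, abs_mul]
          refine mul_le_mul_of_nonneg_right (mul_le_mul_of_nonneg_left ?_ (abs_nonneg _)) (abs_nonneg _)
          exact (hM t ht k l).trans (le_abs_self M)
      _ = |M| * (∑ k, |B k i|) * (∑ l, |B l j|) := by
          rw [Finset.mul_sum]
          refine Finset.sum_congr rfl fun l _ => ?_
          rw [Finset.mul_sum, Finset.sum_mul]
          exact Finset.sum_congr rfl fun k _ => by ring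
      _ ≤ |M| * β * β := by
          have h1 := hcol i
          have h2 := hcol j
          have hki : 0 ≤ ∑ k, |B k i| := Finset.sum_nonneg fun k _ => abs_nonneg _
          have := abs_nonneg M
          gcongr
  · intro i j
    simp only [reduce_apply]
    refine tendsto_finsetSum _ fun l _ => tendsto_finsetSum _ fun k _ => ?_
    exact ((D.tendsto_C k l).const_mul (B k i)).mul_const (B l j)

end Reduced

/-! ### Transport along a continuous linear map `L` with matrix `B` -/

section Transport

variable (D : CovDecomposition N) {V₀ : EuclideanSpace ℝ (Fin N) → ℝ}
  (L : EuclideanSpace ℝ (Fin N') →L[ℝ] EuclideanSpace ℝ (Fin N)) (B : Matrix (Fin N) (Fin N') ℝ)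
  (hB : ∀ x : EuclideanSpace ℝ (Fin N'), WithLp.ofLp (L x) = B *ᵥ WithLp.ofLp x)
include hB

/-- The adjoint of `L` acts by `Bᵀ`. [folklore] -/
private theorem ofLp_adjoint_eq (y : EuclideanSpace ℝ (Fin N)) :
    WithLp.ofLp (L.adjoint y) = Bᵀ *ᵥ WithLp.ofLp y := by
  have h : L.adjoint y = WithLp.toLp 2 (Bᵀ *ᵥ WithLp.ofLp y) := by
    refine ext_inner_right ℝ fun v => ?_
    rw [ContinuousLinearMap.adjoint_inner_left, EuclideanSpace.inner_eq_star_dotProduct,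
      EuclideanSpace.inner_eq_star_dotProduct, star_trivial, star_trivial, hB]
    rw [mulVec_dotProduct_eq, dotProduct_comm]
  rw [h]

/-- `⟪L u, S (L u')⟫ = ⟪u, (Bᵀ S B) u'⟫`. [folklore] -/
private theorem inner_toEuclideanLin_map_eq (S : Matrix (Fin N) (Fin N) ℝ) (u u' : EuclideanSpace ℝ (Fin N')) :
    ⟪L u, Matrix.toEuclideanLin S (L u')⟫ = ⟪u, Matrix.toEuclideanLin (Bᵀ * S * B) u'⟫ := by
  rw [EuclideanSpace.inner_eq_star_dotProduct, EuclideanSpace.inner_eq_star_dotProduct, star_trivial,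
    star_trivial]
  simp only [Matrix.ofLp_toLpLin, Matrix.toLin'_apply]
  rw [hB, hB, dotProduct_comm, dotProduct_reduce, dotProduct_comm]

/-- `S (L u) = L ((Bᵀ S B) u)` as vectors of `ℝ^N`, when `(B Bᵀ) S = S` (`S` symmetric with
`S (B Bᵀ) = S`). [folklore] -/
private theorem toEuclideanLin_map_eq {S : Matrix (Fin N) (Fin N) ℝ} (hS : Sᵀ = S) (hSP : S * (B * Bᵀ) = S)
    (u : EuclideanSpace ℝ (Fin N')) :
    Matrix.toEuclideanLin S (L u) = L (Matrix.toEuclideanLin (Bᵀ * S * B) u) := by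
  apply WithLp.ofLp_injective (p := 2)  -- compare coordinates
  rw [hB]
  simp only [Matrix.ofLp_toLpLin, Matrix.toLin'_apply]
  rw [hB, ← Matrix.mulVec_mulVec, ← Matrix.mulVec_mulVec, proj_mulVec_eq B hS hSP]

/-- **Push-forward of the reduced Gaussian**: `L_* P_{Bᵀ S B} = P_S` for positive semidefinite `S` with
`S (B Bᵀ) = S` (both are centred Gaussians with covariance form `(ξ, S ζ)`; [BBD] §3.1 «`P_C` is supported
on the image of `C`»). [cite: BauerschmidtBodineauDagallier2023, §3.1 p0012 L11–13] -/
theorem map_multivariateGaussian_reduce {S : Matrix (Fin N) (Fin N) ℝ} (hS : S.PosSemidef)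
    (hSP : S * (B * Bᵀ) = S) :
    (multivariateGaussian 0 (Bᵀ * S * B)).map L = multivariateGaussian 0 S := by
  have hS' : (Bᵀ * S * B).PosSemidef := posSemidef_reduce B hS
  refine IsGaussian.ext ?_ ?_
  · show ∫ x, id x ∂_ = ∫ x, id x ∂_
    simp only [id]
    rw [L.integral_id_map IsGaussian.integrable_id, integral_id_multivariateGaussian,
      integral_id_multivariateGaussian, map_zero]
  · ext ξ ζ
    rw [covarianceBilin_map IsGaussian.memLp_two_id, covarianceBilin_multivariateGaussian hS',
      covarianceBilin_multivariateGaussian hS]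
    rw [ofLp_adjoint_eq L B hB ξ, ofLp_adjoint_eq L B hB ζ]
    exact dotProduct_reduce_proj B (transpose_eq_of_posSemidef hS) hSP _ _

/-- Change of variables along `L` for a measurable integrand. [folklore] -/
private theorem integral_map_L {S : Matrix (Fin N) (Fin N) ℝ} (hS : S.PosSemidef) (hSP : S * (B * Bᵀ) = S)
    {g : EuclideanSpace ℝ (Fin N) → ℝ} (hg : Measurable g) :
    ∫ y, g y ∂(multivariateGaussian 0 S) = ∫ x, g (L x) ∂(multivariateGaussian 0 (Bᵀ * S * B)) := by
  rw [← map_multivariateGaussian_reduce L B hB hS hSP,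
    integral_map L.continuous.measurable.aemeasurable hg.aestronglyMeasurable]

variable (hV : Measurable V₀)
include hV

/-- **The renormalised potentials descend**: with `C'_t = Bᵀ C_t B` and `V₀' = V₀ ∘ L`,
`V'_t = V_t ∘ L` for `t ≥ 0` ([BBD] Def 2 (e:V-def), by `L_* P_{C'_t} = P_{C_t}`).
[cite: BauerschmidtBodineauDagallier2023, Definition 2] -/
theorem renormPotential_reduce {D' : CovDecomposition N'} (hC' : ∀ t, D'.C t = Bᵀ * D.C t * B)
    (hCP : ∀ t, 0 ≤ t → D.C t * (B * Bᵀ) = D.C t) {t : ℝ} (ht : 0 ≤ t) (x : EuclideanSpace ℝ (Fin N')) :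
    renormPotential D' (fun z => V₀ (L z)) t x = renormPotential D V₀ t (L x) := by
  unfold renormPotential
  rw [hC' t]
  have key := integral_map_L L B hB (D.posSemidef_C ht) (hCP t ht)
    (g := fun ζ => Real.exp (-V₀ (L x + ζ))) (by exact (hV.comp (measurable_const_add (L x))).neg.exp)
  rw [key]
  simp only [map_add]

/-- `V'_t = V_t ∘ L` as functions (`t ≥ 0`). [cite: BauerschmidtBodineauDagallier2023, Definition 2] -/
theorem renormPotential_reduce_eq {D' : CovDecomposition N'} (hC' : ∀ t, D'.C t = Bᵀ * D.C t * B)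
    (hCP : ∀ t, 0 ≤ t → D.C t * (B * Bᵀ) = D.C t) {t : ℝ} (ht : 0 ≤ t) :
    renormPotential D' (fun z => V₀ (L z)) t = fun x => renormPotential D V₀ t (L x) :=
  funext fun x => renormPotential_reduce D L B hB hV hC' hCP ht x

omit hV hB in
/-- Chain rule for the Hessian quadratic form along `L`: `Hess (f ∘ L)(x)(w, w) = Hess f(Lx)(Lw, Lw)` for
`f ∈ C²`. [cite: BauerschmidtBodineauDagallier2023, §3.3 (the Hessian `Hess V_t`)] -/
theorem hessQF_comp_clm {f : EuclideanSpace ℝ (Fin N) → ℝ} (hf : ContDiff ℝ 2 f)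
    (x w : EuclideanSpace ℝ (Fin N')) :
    hessQF (fun z => f (L z)) x w = hessQF f (L x) (L w) := by
  unfold hessQF
  have h := L.iteratedFDeriv_comp_right hf x (i := 2) le_rfl
  rw [show (fun z => f (L z)) = f ∘ ⇑L from rfl, h, ContinuousMultilinearMap.compContinuousLinearMap_apply]
  congr 1
  funext i
  fin_cases i <;> rfl

/-- **The multiscale condition descends** with the same rates: (e:assCt-mon) for `(C_t, V₀)` on `ℝ^N`
implies (e:assCt-mon) for `(Bᵀ C_t B, V₀ ∘ L)` on `ℝ^{N'}`, provided `V_t ∈ C²` (`t > 0`) and the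
covariances are blind to the complement of the frame (`C_t (B Bᵀ) = C_t`, `Ċ_t (B Bᵀ) = Ċ_t`).
[cite: BauerschmidtBodineauDagallier2023, Theorem 3 (e:assCt-mon)] -/
theorem multiscaleCondition_reduce {D' : CovDecomposition N'} (hC' : ∀ t, D'.C t = Bᵀ * D.C t * B)
    (hCdot' : ∀ t, D'.Cdot t = Bᵀ * D.Cdot t * B) (hCddot' : ∀ t, D'.Cddot t = Bᵀ * D.Cddot t * B)
    (hCP : ∀ t, 0 ≤ t → D.C t * (B * Bᵀ) = D.C t)
    (hCdotP : ∀ t, 0 ≤ t → D.Cdot t * (B * Bᵀ) = D.Cdot t)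
    (hC2 : ∀ t, 0 < t → ContDiff ℝ 2 (renormPotential D V₀ t))
    {lamdot : ℝ → ℝ} (hMS : MultiscaleCondition D V₀ lamdot) :
    MultiscaleCondition D' (fun z => V₀ (L z)) lamdot := by
  intro x t ht u
  have h := hMS (L x) t ht (L u)
  rw [inner_toEuclideanLin_map_eq L B hB, inner_toEuclideanLin_map_eq L B hB, ← hCdot' t, ← hCddot' t,
    toEuclideanLin_map_eq L B hB (transpose_eq_of_posSemidef (D.posSemidef_Cdot t ht.le)) (hCdotP t ht.le),
    ← hCdot' t, ← hessQF_comp_clm L (hC2 t ht), ← renormPotential_reduce_eq D L B hB hV hC' hCP ht.le] at h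
  exact h

/-- **The starting measures correspond**: `E_{ν₀}[h] = E_{ν₀'}[h ∘ L]` for measurable `h`, where
`ν₀ ∝ e^{−V₀} P_{C_∞}` and `ν₀' ∝ e^{−V₀∘L} P_{Bᵀ C_∞ B}` ((e:nu0-Cinfty); push-forward of the tilted
measure). [cite: BauerschmidtBodineauDagallier2023, §3.2 (e:nu0-Cinfty)] -/
theorem integral_nu0_reduce {D' : CovDecomposition N'} (hCinf' : D'.Cinf = Bᵀ * D.Cinf * B)
    (hCinfP : D.Cinf * (B * Bᵀ) = D.Cinf) {h : EuclideanSpace ℝ (Fin N) → ℝ} (hh : Measurable h) :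
    ∫ φ, h φ ∂(nu0 D V₀) = ∫ x, h (L x) ∂(nu0 D' (fun z => V₀ (L z))) := by
  unfold nu0
  rw [integral_tilted, integral_tilted, hCinf']
  have hZ := integral_map_L L B hB D.posSemidef_Cinf hCinfP (g := fun y => Real.exp (-V₀ y))
    (by exact hV.neg.exp)
  have hI := integral_map_L L B hB D.posSemidef_Cinf hCinfP
    (g := fun y => (Real.exp (-V₀ y) / ∫ y, Real.exp (-V₀ y) ∂(multivariateGaussian 0 D.Cinf)) • h y)
    (by exact ((hV.neg.exp).div_const _).smul hh)
  rw [hI, hZ]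

omit hB hV in
/-- The gradient of `f ∘ L` is `L† (∇f ∘ L)`. [folklore] -/
private theorem gradient_comp_clm {f : EuclideanSpace ℝ (Fin N) → ℝ} (hf : Differentiable ℝ f)
    (x : EuclideanSpace ℝ (Fin N')) :
    gradient (fun z => f (L z)) x = L.adjoint (gradient f (L x)) := by
  refine ext_inner_right ℝ fun w => ?_
  have hcomp : fderiv ℝ (fun z => f (L z)) x = (fderiv ℝ f (L x)).comp L := by
    rw [show (fun z => f (L z)) = f ∘ ⇑L from rfl, fderiv_comp x (hf (L x)) L.differentiableAt,
      L.fderiv]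
  rw [gradient, InnerProductSpace.toDual_symm_apply, hcomp, ContinuousLinearMap.comp_apply,
    ContinuousLinearMap.adjoint_inner_left, gradient, InnerProductSpace.toDual_symm_apply]

omit hV in
/-- **The Dirichlet forms correspond**: `(∇(f∘L)(x), Ċ'_0 ∇(f∘L)(x)) = (∇f(Lx), Ċ₀ ∇f(Lx))` with
`Ċ'_0 = Bᵀ Ċ₀ B`, `Ċ₀ (B Bᵀ) = Ċ₀` (the `Ċ₀`-carré du champ of Theorem 3's conclusion).
[cite: BauerschmidtBodineauDagallier2023, Theorem 3 (e:LSI conclusion, `(∇√F)²_{Ċ₀}`)] -/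
theorem inner_gradient_reduce {D' : CovDecomposition N'} (hCdot' : ∀ t, D'.Cdot t = Bᵀ * D.Cdot t * B)
    (hCdotP : ∀ t, 0 ≤ t → D.Cdot t * (B * Bᵀ) = D.Cdot t)
    {f : EuclideanSpace ℝ (Fin N) → ℝ} (hf : Differentiable ℝ f) (x : EuclideanSpace ℝ (Fin N')) :
    ⟪gradient (fun z => f (L z)) x,
        Matrix.toEuclideanLin (D'.Cdot 0) (gradient (fun z => f (L z)) x)⟫ =
      ⟪gradient f (L x), Matrix.toEuclideanLin (D.Cdot 0) (gradient f (L x))⟫ := by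
  rw [gradient_comp_clm L hf x, hCdot' 0, EuclideanSpace.inner_eq_star_dotProduct,
    EuclideanSpace.inner_eq_star_dotProduct, star_trivial, star_trivial]
  simp only [Matrix.ofLp_toLpLin, Matrix.toLin'_apply]
  rw [ofLp_adjoint_eq L B hB, dotProduct_comm,
    dotProduct_reduce_proj B (transpose_eq_of_posSemidef (D.posSemidef_Cdot 0 le_rfl)) (hCdotP 0 le_rfl),
    dotProduct_comm]

end Transport

end Polchinski

end Literature.Analysis.FunctionSpaces

end
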